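import Mathlib.Analysis.Normed.Field.Basic
import Mathlib.Analysis.Normed.Group.Ultra
import Mathlib.Topology.MetricSpace.Ultra.Basic
import Mathlib.Logic.Equiv.Basic
import Literature.AnabelianGeometry.AbsoluteAnabelian.LogShells
import HarnessLib

/-!
# [J-III] §9.5–9.7.3 à la Joshi: theta-values evaluated in log-shells — the crystalline class of a Tate curve,
# the Bloch–Kato exponential / logarithm and Mochizuki's log-shell (local file)

Block-E record file of the abc-iut cell (rung LADDER-ABC:A2.E; seat abc-iut-E-t21, slot T-21). TYPES the objects and stated
results of K. Joshi, *Construction of Arithmetic Teichmüller Spaces III*, arXiv:2401.13508**v4** ("Preliminary version for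
comments", UNREFEREED; bib `Joshi2024ATS3`; locators «p.N l.M» = PDF page N (printed page N − 1), line M of the cell's render),
§9.5 (p.107 l.28–p.108 l.9), §9.6 (p.108 l.10–p.110 l.6), §9.7.1–9.7.3 (p.110 l.7–p.111 l.63); the global class (9.7.4) and
the collation Prop. 9.7.5.1 are the sequel `ThetaEvaluationCollation`. TAKES NO SIDE on [IUTchIII] Cor. 3.12, on Joshi's
claims, or on Mochizuki's reports on them. Typed ≠ proved; typed AS A CANDIDATE ≠ endorsed. Every statement Joshi ASSERTS is
a `Prop`-valued `def` (claim), never an axiom, instance, `sorry` or Literature fact; what FOLLOWS from the signature is proved.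

Carriers (INTERIM CARRIER RULE, plan/E/ASSIGNMENTS.md §0.3; instance-free — carrier types are parameters): `K` = the valued
field `L′_w ⊂ K_w` at a nonarchimedean place `w` of `L′` WITH THE NORM IT INHERITS INSIDE THE RESIDUE FIELD `K_w` OF THE POINT
`y_w` (the holomorphoid enters here and through the cohomology groups only; p.107 l.28–31); `LocalBKDatum K H1Z H1Q` = the
`p`-adic logarithm and `p*` (REUSED by `extends` from abc-iut-L4-t3's `PadicLogOnUnits`, [AbsTopIII] Def. 5.4 (iii)), Joshi's
`p*` (9.6.1.2), the cohomology `H^1(G_{L′_w};K_w, ℤ_p(1)) → H^1(G_{L′_w};K_w, ℚ_p(1))` with the Bloch–Kato subsets `H^1_e`,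
`H^1_f` (9.1.1; merge-debt J3:§9.1 = E-t19), the Kummer map, the Bloch–Kato exponential (9.7.1.1) — cohomology as bare types
and sets (the printed «isomorphism of topological groups» is a bijection here: neither structure is used in §9.5–9.8);
`TateLocalDatum` adds `ℓ` and the root `q^{1/2ℓ}(X/L′_w;K_w)` at `w ∈ V^{odd,ss}_p` (9.6.2).

DICTIONARY rows (kernel lemmas, no claim involved): (D1) Joshi's `p*` = Mochizuki's `p*` of [AbsTopIII] Def. 5.4 (iii)
(`pStar_eq_mlfType_pstar`; Lemma 9.6.1.3 in the reading «amphoric = function of the Prop. 5.8 (i) `G`-invariants»);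
(D2) Joshi's log-shell `I((X/L_v, K_v)) = (1/p*)·log(𝒪^*_{L_v})` (Def. 9.2.1.1) is LITERALLY L4-t3's `logShell` — imported,
not restated — and the printed value `log_p(1 + p*·q^{1/2ℓ})/p*` of (9.7.2.2) lies in `𝒪_{L′_w} ⊆ ℐ` (PROVED,
`xiLogValue_mem_logShell`), while the VALUE of `log_BK` and Lemma 9.6.2.2 stay claims. Reading flags in the docstrings
(Rmk. 9.6.2.1 exponent; Prop. 9.7.2.3's proof proves `𝒪 ⊆ image`). NOT here: §9.1–9.4 (E-t19/E-t20), §9.8 (E-t22), the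
Tate-uniformised point and `Ĉ ≃ Ĝ_m` of 9.6.1–9.6.2, Rmk. 9.7.1.2, any TEST (plan/E/README §5). Standard axioms; sorry-free.
-/

noncomputable section

open Set Metric
open scoped Pointwise

namespace Summit.ABC.IUTFork.Joshi.ATS3

open Literature.AnabelianGeometry.AbsoluteAnabelian

/-! ## 1. (9.6.1.1)–(9.6.1.2): one-units and Joshi's `p*` -/

section OneUnits

variable (K : Type*) [NontriviallyNormedField K]

/-- `Ĝ_m(𝒪_{L′_w}) = 1 + 𝔪_{𝒪_{L′_w}}`, «the group of 1-units of `𝒪_{L′_w}`» ([J-III] (9.6.1.1), p.108 l.31–35): the open unit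
ball around `1`. [claim: Joshi2024ATS3, status: disputed] -/
@[claim "Joshi2024ATS3" "disputed"]
def oneUnits : Set K := ball (1 : K) 1

variable {K}

/-- In an ultrametric field the 1-units are units of norm one: `1 + 𝔪 ⊆ 𝒪^× = {‖x‖ = 1}`. [folklore] -/
theorem oneUnits_subset_sphere [IsUltrametricDist K] : oneUnits K ⊆ sphere (0 : K) 1 := by
  intro x hx
  rw [oneUnits, mem_ball, dist_eq_norm] at hx
  rw [mem_sphere, dist_zero_right]
  have hlt : ‖x - 1‖ < ‖(1 : K)‖ := by rwa [norm_one]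
  have h := IsUltrametricDist.norm_add_eq_max_of_norm_ne_norm (ne_of_lt hlt)
  rwa [sub_add_cancel, max_eq_right hlt.le, norm_one] at h

/-- The principal units `1 + p*·𝒪 = closedBall 1 ‖p*‖` of L4-t3's `PadicLogOnUnits` are 1-units (`‖p*‖ < 1`). [folklore] -/
theorem closedBall_pstar_subset_oneUnits (L : PadicLogOnUnits K) : closedBall (1 : K) ‖L.pstar‖ ⊆ oneUnits K :=
  fun _ hx => mem_ball.2 (lt_of_le_of_lt (mem_closedBall.1 hx) L.norm_pstar_lt_one)

end OneUnits

/-- Joshi's `p* := p` if `p ≥ 3`, `:= 4` if `p = 2` ([J-III] (9.6.1.2), p.108 l.51–59; `p*_w := (p_w)*` for the rational prime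
`p_w` under `w`). The case split is the radius of convergence of the `p`-adic exponential (Rmk. 9.7.1.2, p.110 l.22–45). [claim: Joshi2024ATS3, status: disputed] -/
@[claim "Joshi2024ATS3" "disputed"]
def pStar (p : ℕ) : ℕ := if p = 2 then 4 else p

/-- `2* = 4`. [folklore] -/
theorem pStar_two : pStar 2 = 4 := by simp [pStar]

/-- `p* = p` for `p ≠ 2`. [folklore] -/
theorem pStar_of_ne_two {p : ℕ} (h : p ≠ 2) : pStar p = p := by simp [pStar, h]

/-- **(D1) / Lemma 9.6.1.3 in the [AbsTopIII] reading.** Joshi's `p*` coincides with Mochizuki's `p*` of [AbsTopIII]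
Def. 5.4 (iii) (`p` for `p` odd, `p²` for `p = 2`) on the numerical type `(p, f, e, m)` that [AbsTopIII] Prop. 5.8 (i)
reconstructs from `G_k` — so «the quantity `p*_w` is `G_{L′_w}`-amphoric» ([J-III] Lemma 9.6.1.3, p.108 l.60–64, citing
[Mochizuki 2015] and [Hoshi 2021, Prop. 3.6]) holds in the reading «amphoric = a function of the Prop. 5.8 (i) invariants».
The general amphoricity predicate of [J-III] §2 is E-t5's (merge-debt). [cite: MochizukiAbsTopIII2015, Def 5.4 (iii) p. 126] -/
theorem pStar_eq_mlfType_pstar (t : MLFType) : pStar t.p = t.pstar := by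
  unfold pStar MLFType.pstar
  split_ifs with h
  · rw [h]; norm_num
  · rfl

/-! ## 2. The local cohomological carrier at a nonarchimedean place (9.1.1 fragments, 9.7.1, Kummer theory) -/

/-- **Local Bloch–Kato datum at a nonarchimedean place `w` of `L′` for the holomorphoid `y`** (SIGNATURE). Extends L4-t3's
`PadicLogOnUnits K` (the `p`-adic logarithm on `𝒪^×_{L′_w}` — [J-III] p.110 l.21: «`log_p` the principal branch,
`log_p(p) = 0`» — and the element `p* ∈ L′_w` with `log(1 + p*𝒪) = p*𝒪`). Adds: the residue characteristic `p = p_w` with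
`p* = (p_w)*` of (9.6.1.2) as an element of `L′_w`; the cohomology `H^1(G_{L′_w};K_w, ℤ_p(1))` (`H1Z`) mapping to
`H^1(G_{L′_w};K_w, ℚ_p(1))` (`H1Q`) «with `B_cris` constructed using the completed algebraic closure of `L′_w` provided by `K_w`»
(p.107 l.45–49), its Bloch–Kato subsets `H^1_e ⊆ H^1(G, ℚ_p(1))` («crystalline, Frobenius trivial extensions», 9.1.1 p.95
l.33–44) and `H^1_f` (merge-debt: E-t19 types (9.1.1.3)–(9.1.1.4)); the Kummer map `x ↦ {x^{1/p^n}}_n` ([ATS II½] Prop. 7.2.2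
(2): `H^1(G_{L_v};K_v, ℤ_p(1)) ≃ lim L_v^*/L_v^{*p^n}`; the class of a compatible system of roots depends only on the element —
junk value at `0`); and the Bloch–Kato exponential `e_BK : L′_w ≃ H^1_e(G_{L′_w}, ℚ_p(1))` ([J-III] (9.7.1.1), p.110 l.8–20,
«isomorphism of topological groups [FF18, 10.6.19] … explicitly `x ↦ (e^{p^m·x})^{1/p^m}`, `m ≫ 0`», typed as a bijection:
neither the group law nor the topology of cohomology is used in §9.5–9.8). [claim: Joshi2024ATS3, status: disputed] -/
@[claim "Joshi2024ATS3" "disputed"]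
structure LocalBKDatum (K : Type*) [NontriviallyNormedField K] (H1Z H1Q : Type*) extends PadicLogOnUnits K where
  /-- the rational prime `p_w` under `w` -/
  p : ℕ
  /-- `p_w` is prime -/
  prime_p : p.Prime
  /-- L4-t3's abstract `p* ∈ L′_w` IS Joshi's `(p_w)*` of (9.6.1.2) -/
  pstar_eq_cast : pstar = ((pStar p : ℕ) : K)
  /-- `H^1(G;K_w, ℤ_p(1)) → H^1(G;K_w, ℚ_p(1))` (`⊗ ℚ_p`) -/
  toQ : H1Z → H1Q
  /-- `H^1_e(G_{L′_w};K_w, ℚ_p(1)) ⊆ H^1(G_{L′_w};K_w, ℚ_p(1))` -/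
  H1e : Set H1Q
  /-- `H^1_f(G_{L′_w};K_w, ℚ_p(1))` (crystalline classes) -/
  H1f : Set H1Q
  /-- the Kummer class `{x^{1/p^n}}_{n ≥ 0} ∈ H^1(G, ℤ_p(1))` of `x ∈ L′_w^×` (junk at `0`) -/
  kummer : K → H1Z
  /-- the Bloch–Kato exponential (9.7.1.1) -/
  eBK : K ≃ H1e

namespace LocalBKDatum

variable {K : Type*} [NontriviallyNormedField K] {H1Z H1Q : Type*} (C : LocalBKDatum K H1Z H1Q)

/-- The integral Bloch–Kato module `H^1_e(G, ℤ_p(1)) := H^1(G, ℤ_p(1)) ∩ H^1_e(G, ℚ_p(1))` ([J-III] 9.1.1, p.95 l.36–39;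
p.111 l.6–12). [claim: Joshi2024ATS3, status: disputed] -/
@[claim "Joshi2024ATS3" "disputed"]
def H1eInt : Set H1Z := C.toQ ⁻¹' C.H1e

/-- The Bloch–Kato logarithm `log_BK : H^1_e(G_{L′_w}, ℚ_p(1)) ≃ L′_w`, «the isomorphism inverse to the Bloch–Kato exponential»
([J-III] (9.7.2.1), p.110 l.46–54). DERIVED definition. [claim: Joshi2024ATS3, status: disputed] -/
@[claim "Joshi2024ATS3" "disputed"]
def logBK : C.H1e ≃ K := C.eBK.symm

/-- The image under `log_BK` of the integral module `H^1_e(G_{L_w}, ℤ_p(1))` — the right-hand side of Prop. 9.7.2.3's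
identification ([J-III] p.111 l.20–26). [claim: Joshi2024ATS3, status: disputed] -/
@[claim "Joshi2024ATS3" "disputed"]
def logBKImage : Set K := {x | ∃ (c : H1Z) (h : C.toQ c ∈ C.H1e), C.logBK ⟨C.toQ c, h⟩ = x}

/-- CLAIM (9.1.1.4), first equality: `H^1_e(G_E, ℚ_p(1)) = H^1_f(G_E, ℚ_p(1))` ([J-III] p.95 l.45–52, citing Bloch–Kato 1990,
Nekovář 1993, Perrin-Riou 1994; «The first equality will play an important role»; used in the proof of Lemma 9.6.2.2, p.110
l.1–6). Merge-debt: E-t19's J3:§9.1. HYPOTHESIS, never asserted. [claim: Joshi2024ATS3, status: disputed] -/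
@[claim "Joshi2024ATS3" "disputed"]
def H1eEqH1f : Prop := C.H1e = C.H1f

/-- CLAIM (Perrin-Riou step of the proof of Lemma 9.6.2.2, [J-III] p.109 l.85–p.110 l.1: «[Perrin-Riou, 1994], where it is
established that 1-units provide crystalline cohomology classes»): the Kummer class of every 1-unit lies in `H^1_f`.
HYPOTHESIS, never asserted. [claim: Joshi2024ATS3, status: disputed] -/
@[claim "Joshi2024ATS3" "disputed"]
def OneUnitsKummerFontaine : Prop := ∀ u : K, u ∈ oneUnits K → C.toQ (C.kummer u) ∈ C.H1f

/-- CLAIM ([J-III] p.111 l.1–12): «if `ξ ∈ 𝒪^*_{L′_w}` with `ξ ≡ 1 mod (p*·𝒪_{L′_w})` then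
`ξ ∈ H^1_e(G_{L′_w}, ℤ_p(1)) = H^1(G_{L′_w}, ℤ_p(1)) ∩ H^1_e(G_{L′_w}, ℚ_p(1))`». HYPOTHESIS, never asserted. [claim: Joshi2024ATS3, status: disputed] -/
@[claim "Joshi2024ATS3" "disputed"]
def PrincipalUnitsCrystalline : Prop := ∀ u : K, u ∈ closedBall (1 : K) ‖C.pstar‖ → C.kummer u ∈ C.H1eInt

/-- CLAIM (the formula of (9.7.2.2), [J-III] p.110 l.55–75, for a general principal unit — READING: print displays it for
`ξ = 1 + p*_w·q^{1/2ℓ}` («`log_BK(ξ) = log_p(p*_w·(1 + p*_w·q^{1/2ℓ}))/p*_w = log_p(1 + p*_w·q^{1/2ℓ})/p*_w`») and uses the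
general form implicitly in the proof of Prop. 9.7.2.3 («any element of the form `log(1 + p*_w𝒪_{L′_w})/p*_w` is evidently in
the image of `log_BK`», p.111 l.31–36)): for `ξ ≡ 1 mod p*`, `log_BK(ξ) = p*⁻¹·log_p(ξ)`. HYPOTHESIS, never asserted. [claim: Joshi2024ATS3, status: disputed] -/
@[claim "Joshi2024ATS3" "disputed"]
def LogBKPrincipalUnits : Prop :=
  ∀ (u : K) (hu : u ∈ closedBall (1 : K) ‖C.pstar‖) (he : C.toQ (C.kummer u) ∈ C.H1e),
    C.logBK ⟨C.toQ (C.kummer u), he⟩ = C.pstar⁻¹ * C.log u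

/-- CLAIM (Prop. 9.7.2.3, first clause, [J-III] p.111 l.17–26): «Mochizuki's log-shell `I(hol(X/L′_w)_{y_w})` (9.2.1.2) can be
identified with the image, under the Bloch–Kato logarithm (9.7.2.1), of the Bloch–Kato `ℤ_p`-module
`H^1_e(G_{L_w}, ℤ_p(1)) = H^1(G_{L_w}, ℤ_p(1)) ∩ H^1_e(G_{L_w}, ℚ_p(1))`». The log-shell is L4-t3's `logShell` (dictionary (D2)).
Faithfulness note: the printed proof («surjectivity … any element of the form `log(1 + p*_w𝒪)/p*_w` is evidently in the
image») establishes `𝒪_{L′_w} ⊆ image` (`integers_subset_logBKImage_of` below), and `𝒪 ⊆ ℐ = p*⁻¹·log(𝒪^×)` may be strict.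
HYPOTHESIS, never asserted. [claim: Joshi2024ATS3, status: disputed] -/
@[claim "Joshi2024ATS3" "disputed"]
def LogShellEqLogBKImage : Prop := logShell C.toPadicLogOnUnits = C.logBKImage

/-- The logarithm of a principal unit has norm `≤ ‖p*‖` (L4-t3's axiom `log(1 + p*𝒪) = p*𝒪`).
[cite: MochizukiAbsTopIII2015, Def 5.4 (iii) p. 126] -/
theorem norm_log_le_of_mem_closedBall {u : K} (hu : u ∈ closedBall (1 : K) ‖C.pstar‖) : ‖C.log u‖ ≤ ‖C.pstar‖ := by
  have h : C.log u ∈ closedBall (0 : K) ‖C.pstar‖ := by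
    rw [← C.image_principalUnits]; exact ⟨u, hu, rfl⟩
  simpa [mem_closedBall, dist_zero_right] using h

/-- For a principal unit `u`, `p*⁻¹·log(u) ∈ 𝒪_{L′_w} = closedBall 0 1`. [cite: MochizukiAbsTopIII2015, Def 5.4 (iii) p. 126] -/
theorem pstarInv_mul_log_mem_integers {u : K} (hu : u ∈ closedBall (1 : K) ‖C.pstar‖) :
    C.pstar⁻¹ * C.log u ∈ closedBall (0 : K) 1 := by
  rw [mem_closedBall, dist_zero_right, norm_mul, norm_inv]
  have hp : 0 < ‖C.pstar‖ := norm_pos_iff.2 C.pstar_ne_zero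
  rw [inv_mul_le_iff₀ hp, mul_one]
  exact C.norm_log_le_of_mem_closedBall hu

/-- For a principal unit `u`, `p*⁻¹·log(u)` lies in Mochizuki's log-shell `ℐ = p*⁻¹·log(𝒪^×)` (`𝒪 ⊆ ℐ`, L4-t3's
`closedBall_subset_logShell`). [cite: MochizukiAbsTopIII2015, Def 5.4 (iii) p. 126] -/
theorem pstarInv_mul_log_mem_logShell [IsUltrametricDist K] {u : K} (hu : u ∈ closedBall (1 : K) ‖C.pstar‖) :
    C.pstar⁻¹ * C.log u ∈ logShell C.toPadicLogOnUnits :=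
  closedBall_subset_logShell C.toPadicLogOnUnits (C.pstarInv_mul_log_mem_integers hu)

/-- **What the printed proof of Prop. 9.7.2.3 proves**, DERIVED from the two claims it uses: if principal units give
`H^1_e`-classes with `log_BK = p*⁻¹·log_p`, then `𝒪_{L′_w} ⊆ log_BK(H^1_e(G, ℤ_p(1)))` («any element of the form
`log(1 + p*_w𝒪_{L′_w})/p*_w` is evidently in the image», [J-III] p.111 l.31–36). [folklore] -/
theorem integers_subset_logBKImage_of (h1 : C.PrincipalUnitsCrystalline) (h2 : C.LogBKPrincipalUnits) :
    closedBall (0 : K) 1 ⊆ C.logBKImage := by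
  intro y hy
  have hy' : C.pstar * y ∈ closedBall (0 : K) ‖C.pstar‖ := by
    rw [mem_closedBall, dist_zero_right, norm_mul]
    rw [mem_closedBall, dist_zero_right] at hy
    exact mul_le_of_le_one_right (norm_nonneg _) hy
  rw [← C.image_principalUnits] at hy'
  obtain ⟨u, hu, huy⟩ := hy'
  refine ⟨C.kummer u, h1 u hu, ?_⟩
  rw [h2 u hu (h1 u hu), huy, ← mul_assoc, inv_mul_cancel₀ C.pstar_ne_zero, one_mul]

end LocalBKDatum

/-! ## 3. (9.6.2), Rmk. 9.6.2.1, Lemma 9.6.2.2, (9.7.2.2), Prop. 9.7.2.3: the class of a Tate curve at `w ∈ V^{odd,ss}_p` -/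

/-- **Local Tate datum at `w ∈ V^{odd,ss}_p ≠ ∅`** ([J-III] 9.6.1–9.6.2, p.108 l.16–p.109 l.57; SIGNATURE): a `LocalBKDatum` at a
place of ODD residue characteristic where `C/L′_w` is a Tate curve, together with `ℓ` and the chosen `2ℓ`-th root
`q^{1/2ℓ} = q^{1/2ℓ}(X/L′_w;K_w)` of the Tate parameter, which lies in `L′_w` because «the `2ℓ`-torsion points of `C/L` are defined
over `L′` and hence … over `L′_w`. In particular `L′_w` contains the `2ℓ`th-root of any Tate parameter» (9.6.2 p.109 l.1–6; the
reason, §2.4/§3.1/§3.3, is E-t6's block), and in `𝔪_{L′_w} ∖ {0}` (`|q| < 1`). [claim: Joshi2024ATS3, status: disputed] -/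
@[claim "Joshi2024ATS3" "disputed"]
structure TateLocalDatum (K : Type*) [NontriviallyNormedField K] (H1Z H1Q : Type*) extends LocalBKDatum K H1Z H1Q where
  /-- `w ∈ V^{odd,ss}_p`: the residue characteristic is odd -/
  p_ne_two : p ≠ 2
  /-- the prime `ℓ` of the initial theta data (§3.3) -/
  l : ℕ
  /-- `ℓ ≥ 1` -/
  one_le_l : 1 ≤ l
  /-- the chosen `2ℓ`-th root `q^{1/2ℓ}(X/L′_w;K_w) ∈ 𝒪_{L′_w}` of the Tate parameter -/
  q2l : K
  /-- `q^{1/2ℓ} ≠ 0` -/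
  q2l_ne_zero : q2l ≠ 0
  /-- `|q^{1/2ℓ}| < 1` -/
  norm_q2l_lt_one : ‖q2l‖ < 1

namespace TateLocalDatum

variable {K : Type*} [NontriviallyNormedField K] {H1Z H1Q : Type*} (D : TateLocalDatum K H1Z H1Q)

/-- At `w ∈ V^{odd,ss}_p`, `p* = p` ((9.6.1.2) with `p ≥ 3`). [folklore] -/
theorem pstar_eq_cast_p : D.pstar = ((D.p : ℕ) : K) := by rw [D.pstar_eq_cast, pStar_of_ne_two D.p_ne_two]

/-- The Tate parameter `q = q(X/L′_w;K_w) := (q^{1/2ℓ})^{2ℓ}` ([J-III] 9.6.2, p.109 l.6–7). [claim: Joshi2024ATS3, status: disputed] -/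
@[claim "Joshi2024ATS3" "disputed"]
def tateParam : K := D.q2l ^ (2 * D.l)

/-- `q ≠ 0`. [folklore] -/
theorem tateParam_ne_zero : D.tateParam ≠ 0 := pow_ne_zero _ D.q2l_ne_zero

/-- `|q| < 1`. [folklore] -/
theorem norm_tateParam_lt_one : ‖D.tateParam‖ < 1 := by
  rw [tateParam, norm_pow]
  exact pow_lt_one₀ (norm_nonneg _) D.norm_q2l_lt_one (by have := D.one_le_l; omega)

/-- The 1-unit `1 + p*·q^{1/2ℓ}(X/L′_w;K_w) ∈ Ĝ_m(𝒪_{L′_w}) = 1 + 𝔪_{𝒪_{L′_w}} ⊂ 𝒪^*_{L′_w}` ([J-III] 9.6.2, p.109 l.6–19), whose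
compatible system of `p^n`-th roots `ξ_w = {(1 + p*·q^{1/2ℓ})^{1/p^n}}_{n ≥ 0}` (p.109 l.45–57) is Joshi's class. [claim: Joshi2024ATS3, status: disputed] -/
@[claim "Joshi2024ATS3" "disputed"]
def tateOneUnit : K := 1 + D.pstar * D.q2l

/-- Rmk. 9.6.2.1 ([J-III] p.109 l.58–61): «By taking the 1-units `1 + p*·q^{j/2ℓ}` for `j = 1, …, ℓ*`, one may similarly construct
crystalline, Frobenius invariant cohomology classes arising from Mochizuki's theta-values `q^{j/2ℓ}` [Mochizuki, 2009,
Prop. 1.4]». TYPED WITH THE EXPONENT `j` OF `q^{1/2ℓ}` AS A PARAMETER — READING FLAG: print has `q^{j/2ℓ}`, whereas [EtTh]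
Prop. 1.4 / [IUTchII] and [ATS II] arXiv:2303.01662 §5.1 have the theta values `q^{j²/2ℓ}`; instantiate `j ↦ j` or `j ↦ j²`. [claim: Joshi2024ATS3, status: disputed] -/
@[claim "Joshi2024ATS3" "disputed"]
def thetaOneUnit (j : ℕ) : K := 1 + D.pstar * D.q2l ^ j

/-- `thetaOneUnit 1` is the Tate 1-unit. [folklore] -/
theorem thetaOneUnit_one : D.thetaOneUnit 1 = D.tateOneUnit := by simp [thetaOneUnit, tateOneUnit]

/-- `1 + p*·q^{j/2ℓ} ≡ 1 mod p*·𝒪`: it lies in `closedBall 1 ‖p*‖` (`‖q^{1/2ℓ}‖ ≤ 1`). [folklore] -/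
theorem thetaOneUnit_mem_closedBall (j : ℕ) : D.thetaOneUnit j ∈ closedBall (1 : K) ‖D.pstar‖ := by
  rw [mem_closedBall, dist_eq_norm, thetaOneUnit, add_sub_cancel_left, norm_mul, norm_pow]
  exact mul_le_of_le_one_right (norm_nonneg _) (pow_le_one₀ (norm_nonneg _) D.norm_q2l_lt_one.le)

/-- `1 + p*·q^{1/2ℓ} ≡ 1 mod p*·𝒪`. [folklore] -/
theorem tateOneUnit_mem_closedBall : D.tateOneUnit ∈ closedBall (1 : K) ‖D.pstar‖ := by
  rw [← thetaOneUnit_one]; exact D.thetaOneUnit_mem_closedBall 1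

/-- `1 + p*·q^{j/2ℓ} ∈ Ĝ_m(𝒪_{L′_w}) = 1 + 𝔪` ((9.6.1.1)). [folklore] -/
theorem thetaOneUnit_mem_oneUnits (j : ℕ) : D.thetaOneUnit j ∈ oneUnits K :=
  closedBall_pstar_subset_oneUnits D.toPadicLogOnUnits (D.thetaOneUnit_mem_closedBall j)

/-- `1 + p*·q^{1/2ℓ} ∈ Ĝ_m(𝒪_{L′_w}) = 1 + 𝔪` ([J-III] p.109 l.10–15). [folklore] -/
theorem tateOneUnit_mem_oneUnits : D.tateOneUnit ∈ oneUnits K :=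
  closedBall_pstar_subset_oneUnits D.toPadicLogOnUnits D.tateOneUnit_mem_closedBall

/-- `1 + p*·q^{1/2ℓ} ∈ 𝒪^*_{L′_w}` (norm one; [J-III] p.109 l.16–19), in an ultrametric `L′_w`. [folklore] -/
theorem tateOneUnit_mem_sphere [IsUltrametricDist K] : D.tateOneUnit ∈ sphere (0 : K) 1 :=
  oneUnits_subset_sphere D.tateOneUnit_mem_oneUnits

/-- `1 + p*·q^{1/2ℓ} ≠ 0` in an ultrametric `L′_w`. [folklore] -/
theorem tateOneUnit_ne_zero [IsUltrametricDist K] : D.tateOneUnit ≠ 0 := by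
  have h := D.tateOneUnit_mem_sphere
  rw [mem_sphere, dist_zero_right] at h
  exact norm_ne_zero_iff.1 (by rw [h]; exact one_ne_zero)

/-- **Joshi's class `ξ_w = ξ(X/L′_w;K_w) ∈ H^1(G_{L′_w};K_w, ℤ_p(1))`**: the Kummer class of the compatible system
`{(1 + p*·q^{1/2ℓ}(X/L′_w;K_w))^{1/p^n}}_{n=0,1,2,…}` ([J-III] 9.6.2, p.109 l.45–57; Lemma 9.6.2.2). [claim: Joshi2024ATS3, status: disputed] -/
@[claim "Joshi2024ATS3" "disputed"]
def xiClass : H1Z := D.kummer D.tateOneUnit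

/-- The classes of Rmk. 9.6.2.1 from the 1-units `1 + p*·q^{j/2ℓ}` (exponent as a parameter, see `thetaOneUnit`). [claim: Joshi2024ATS3, status: disputed] -/
@[claim "Joshi2024ATS3" "disputed"]
def xiClassPow (j : ℕ) : H1Z := D.kummer (D.thetaOneUnit j)

/-- The printed right-hand side of (9.7.2.2): `log_p(1 + p*_w·q^{1/2ℓ}(X/L′_w;K_w))/p*_w ∈ L′_w` ([J-III] p.110 l.57–75). [claim: Joshi2024ATS3, status: disputed] -/
@[claim "Joshi2024ATS3" "disputed"]
def xiLogValue : K := D.pstar⁻¹ * D.log D.tateOneUnit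

/-- CLAIM **Lemma 9.6.2.2** ([J-III] p.109 l.62–p.110 l.6): «The compatible system `ξ_w = {(1 + p*·q^{1/2ℓ}(X/L′_w;K_w))^{1/p^n}}`
defines a crystalline, Frobenius invariant Galois cohomology class `ξ_w ∈ H^1_e(G_{L′_w};K_w, ℤ_p(1))`» (proof offered: Colmez
1998 Thm. II.3.21 / Colmez 1992, or Perrin-Riou 1994 + `H^1_e = H^1_f`). HYPOTHESIS, never asserted; see `xiCrystalline_of`. [claim: Joshi2024ATS3, status: disputed] -/
@[claim "Joshi2024ATS3" "disputed"]
def XiCrystalline : Prop := D.xiClass ∈ D.H1eInt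

/-- CLAIM **(9.7.2.2)** ([J-III] p.110 l.55–75): `log_BK(ξ(X/L′_w;K_w)) = log_p(1 + p*_w·q^{1/2ℓ}(X/L′_w;K_w))/p*_w` (the
membership `∈ I((X/L′_w, K_w))` printed with it is PROVED below). Stated with the membership of Lemma 9.6.2.2 as its first
component (`log_BK` is only defined on `H^1_e`). HYPOTHESIS, never asserted. [claim: Joshi2024ATS3, status: disputed] -/
@[claim "Joshi2024ATS3" "disputed"]
def LogBKXiFormula : Prop := ∃ h : D.toQ D.xiClass ∈ D.H1e, D.logBK ⟨D.toQ D.xiClass, h⟩ = D.xiLogValue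

/-- CLAIM **Proposition 9.7.2.3** ([J-III] p.111 l.17–30; hypotheses «`L, C, X, L′` as in §2.4, §3.1, §3.3; `w ∈ V^{odd,ss}_p ≠ ∅`
(so `p` is odd)» are the datum): the log-shell `I(hol(X/L′_w)_{y_w})` is the `log_BK`-image of `H^1_e(G_{L_w}, ℤ_p(1))`, AND
`log_BK(ξ(X/L′_w;K_w)) ∈ I((X/L′_w;K_w))`. HYPOTHESIS, never asserted; see `prop9723_of`. [claim: Joshi2024ATS3, status: disputed] -/
@[claim "Joshi2024ATS3" "disputed"]
def Prop9723 : Prop :=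
  D.LogShellEqLogBKImage ∧ ∃ h : D.toQ D.xiClass ∈ D.H1e, D.logBK ⟨D.toQ D.xiClass, h⟩ ∈ logShell D.toPadicLogOnUnits

/-- **(D2), PROVED**: the printed value `log_p(1 + p*·q^{1/2ℓ})/p*` lies in `𝒪_{L′_w}`. [cite: MochizukiAbsTopIII2015, Def 5.4 (iii) p. 126] -/
theorem xiLogValue_mem_integers : D.xiLogValue ∈ closedBall (0 : K) 1 :=
  D.pstarInv_mul_log_mem_integers D.tateOneUnit_mem_closedBall

/-- **(D2), PROVED**: the printed value `log_p(1 + p*·q^{1/2ℓ})/p*` lies in Mochizuki's log-shell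
`I((X/L′_w, K_w)) = p*⁻¹·log(𝒪^×_{L′_w})` — the «`∈ I((X/L′_w, K_w))`» of (9.7.2.2) ([J-III] p.110 l.74–75), from L4-t3's `𝒪 ⊆ ℐ`.
[cite: MochizukiAbsTopIII2015, Def 5.4 (iii) p. 126] -/
theorem xiLogValue_mem_logShell [IsUltrametricDist K] : D.xiLogValue ∈ logShell D.toPadicLogOnUnits :=
  D.pstarInv_mul_log_mem_logShell D.tateOneUnit_mem_closedBall

/-- Lemma 9.6.2.2 DERIVED along the printed proof: 1-units give `H^1_f`-classes (Perrin-Riou) and `H^1_e = H^1_f` ((9.1.1.4))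
⟹ `ξ_w ∈ H^1_e(G;K_w, ℤ_p(1))` ([J-III] p.109 l.76–p.110 l.6). [folklore] -/
theorem xiCrystalline_of (hF : D.OneUnitsKummerFontaine) (hef : D.H1eEqH1f) : D.XiCrystalline := by
  show D.toQ (D.kummer D.tateOneUnit) ∈ D.H1e
  rw [show D.H1e = D.H1f from hef]
  exact hF _ D.tateOneUnit_mem_oneUnits

/-- Lemma 9.6.2.2 DERIVED from the p.111 claim «`ξ ≡ 1 mod p*` ⟹ `ξ ∈ H^1_e(G, ℤ_p(1))`». [folklore] -/
theorem xiCrystalline_of_principalUnitsCrystalline (h : D.PrincipalUnitsCrystalline) : D.XiCrystalline :=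
  h _ D.tateOneUnit_mem_closedBall

/-- (9.7.2.2) DERIVED from the two p.111 claims (membership and the general formula `log_BK = p*⁻¹·log_p`). [folklore] -/
theorem logBKXiFormula_of (h1 : D.PrincipalUnitsCrystalline) (h2 : D.LogBKPrincipalUnits) : D.LogBKXiFormula :=
  ⟨h1 _ D.tateOneUnit_mem_closedBall, h2 _ D.tateOneUnit_mem_closedBall _⟩

/-- Given the value (9.7.2.2), `log_BK(ξ_w)` lies in the log-shell — the second clause of Prop. 9.7.2.3, DERIVED.
[cite: MochizukiAbsTopIII2015, Def 5.4 (iii) p. 126] -/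
theorem logBK_xi_mem_logShell_of [IsUltrametricDist K] (h : D.LogBKXiFormula) :
    ∃ he : D.toQ D.xiClass ∈ D.H1e, D.logBK ⟨D.toQ D.xiClass, he⟩ ∈ logShell D.toPadicLogOnUnits := by
  obtain ⟨he, hval⟩ := h
  exact ⟨he, hval ▸ D.xiLogValue_mem_logShell⟩

/-- Prop. 9.7.2.3 DERIVED from its first clause (claim) and (9.7.2.2). [folklore] -/
theorem prop9723_of [IsUltrametricDist K] (h1 : D.LogShellEqLogBKImage) (h2 : D.LogBKXiFormula) : D.Prop9723 :=
  ⟨h1, D.logBK_xi_mem_logShell_of h2⟩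

end TateLocalDatum

/-! ## 4. (9.7.3): products over the places `w ∈ V_{L′,p}` -/

section Products

variable {W : Type*} {K H1Z H1Q : W → Type*} [∀ w, NontriviallyNormedField (K w)]
  (C : ∀ w, LocalBKDatum (K w) (H1Z w) (H1Q w))

/-- `e_BK : ∏_{w ∈ V_{L′,p}} L′_w ≃ ∏_{w ∈ V_{L′,p}} H^1_e(G_{L′_w}, ℚ_p(1))`, «one can obviously extend the above isomorphism `e_BK`
to the product» ([J-III] 9.7.3, p.111 l.37–51; the index type `W` is `V_{L′,p}`). DERIVED definition. [claim: Joshi2024ATS3, status: disputed] -/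
@[claim "Joshi2024ATS3" "disputed"]
def eBKPi : (∀ w, K w) ≃ (∀ w, (C w).H1e) := Equiv.piCongrRight fun w => (C w).eBK

/-- `log_BK : ∏_w H^1_e(G_{L′_w}, ℚ_p(1)) ≃ ∏_w L′_w` ([J-III] 9.7.3, p.111 l.52–63). DERIVED definition. [claim: Joshi2024ATS3, status: disputed] -/
@[claim "Joshi2024ATS3" "disputed"]
def logBKPi : (∀ w, (C w).H1e) ≃ (∀ w, K w) := (eBKPi C).symm

/-- The product `log_BK` is `log_BK` in each factor. [folklore] -/
theorem logBKPi_apply (c : ∀ w, (C w).H1e) (w : W) : logBKPi C c w = (C w).logBK (c w) := rfl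

end Products

end Summit.ABC.IUTFork.Joshi.ATS3

end
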